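import Summits.AtomisticToContinuum.HydrodynamicLimit.Theorems.TransferActivityTails.Negative.EquilibriumReduction
import Summits.AtomisticToContinuum.HydrodynamicLimit.Theorems.OneFlightGossipEngineEnergyCurrentTailsLevelCensusPreCollisionFlux
import Literature.MathematicalPhysics.KineticTheory.HardSphereJumpTelescoping
import Literature.Analysis.FluidPDE.HardSphereWindowEnumeration
import HarnessLib

/-!
# The signed energy gains of one sphere telescope along a good orbit (stub `stub_coboundary`)

Crux `Summit.AtomisticToContinuum.HydrodynamicLimit.Theses.OneFlightGossipEngine.EnergyActivityTails`
(stmt-AtomisticToContinuum-17703), line `Sketch` (card `coboundary-hot-cold-split`), registered stub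
`stub_coboundary : Coboundary` (K2; the defs `Cfg`, `gainOf`, `Coboundary` re-declared verbatim from the line skeleton —
Theorems files cannot import the crux workfile).

**The coboundary identity.**  Along a good orbit of the hard-sphere flow `Φ` of `N + 1` spheres of diameter
`hsDiameter σ N ≤ σ < 1/2` on `𝕋³` (regular geometry, binary collisions), for every window `(a, b]` and particle `i`,
`Σ_{collisions in (a, b]} gainOf N i = (‖v_i(b)‖² − ‖v_i(a)‖²)/2`, where the gain of the ordered record `c` is
`𝟙{c.fst = i} (‖v_fst⁺‖² − ‖v_fst⁻‖²)/2`.  Proof (trajectory plumbing, no dynamics beyond the prelude):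

* at a collision time `t` of the orbit the ordered contact pairs are `(p, q), (q, p)`
  (`IsHardSphereTrajectory.contactPairs_eq_pair`); the pair sum of `gainOf N i` is the recorded jump
  `(‖v_i(t)‖² − ‖v_i(t⁻)‖²)/2` if `i ∈ {p, q}` (pre-collisional velocity read through the partner,
  `IsHardSphereTrajectory.partner_eq`) and `0` otherwise (`sum_contactPairs_gainOf_of_participates / _of_not_participates`);
* over the window `(0, h]` the collision times of `i` are its enumerated collision times `t_0 < ⋯ < t_{J−1}`
  (`HardSphereFlow.nthCollisionTimeOf_mem_window`, `strictMonoOn_nthCollisionTimeOf_window`,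
  `exists_lt_ncard_nthCollisionTimeOf_eq` of `HardSphereWindowEnumeration`), the recorded pre-collisional velocities are
  flight velocities, `v_i(t_0⁻) = v_i(0)`, `v_i(t_{n+1}⁻) = v_i(t_n)`
  (`HardSphereFlow.preVel_partner_nthCollisionTimeOf_zero / _succ` of `HardSphereJumpTelescoping`), so the jumps telescope
  (`Finset.sum_range_sub`), and `v_i(h) = v_i(t_{J−1})` (`v_i(h) = v_i(0)` if `J = 0`) because `i` has no collision in
  `(t_{J−1}, h]` (`HardSphereFlow.vel_flow_eq_of_forall_not_participates`) — `collisionSum_gainOf_Ioc_zero`;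
* a general window `(a, b]` is the window `(0, b − a]` of the orbit of `Φ_a z`
  (`EnergyCurrentTailsLevelCensus.collisionSum_Ioc_eq_collisionSum_flow`; the gain does not read the time stamp) and
  `Φ_b z = Φ_{b−a} (Φ_a z)` (group property on the good set).

References: I. Gallagher, L. Saint-Raymond, B. Texier, *From Newton to Boltzmann* (2013) §4.1, Prop. 4.1.1 (good set,
locally finite binary collisions); C. Kipnis, C. Landim, *Scaling Limits of Interacting Particle Systems* (1999) App. 1 §5–6
(jump functionals along a trajectory as coboundaries).
-/

noncomputable section

open MeasureTheory Filter Set Topology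
open scoped ENNReal InnerProductSpace BigOperators

namespace Summit.AtomisticToContinuum.HydrodynamicLimit.Theorems.EnergyActivityTailsCoboundary

open Literature.MathematicalPhysics.KineticTheory Literature.Analysis.FluidPDE
open Summit.AtomisticToContinuum.HydrodynamicLimit.Theorems.TransferActivityTailsNegative (Flow Rec)

/-! ## The statement (verbatim from the line skeleton) -/

/-- Configurations of `N + 1` spheres on `𝕋³`. -/
abbrev Cfg (N : ℕ) : Type := Config (N + 1) (Fin 3) T3

/-- Signed kinetic-energy change of `fst` in the record `c` (the GAIN of `i`). -/
def gainOf (N : ℕ) (i : Fin (N + 1)) (c : Rec N) : ℝ :=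
  if c.fst = i then (‖c.postVel.1‖ ^ 2 - ‖c.preVel.1‖ ^ 2) / 2 else 0

/-- **K2 — COBOUNDARY (telescoping of the signed gains).** Along a good orbit of a hard-sphere flow on `𝕋³`
(`0 < σ < 1/2`, so the geometry is regular and collisions are binary) the window sum over `(a, b]` of `i`'s signed energy
gains is the change of `i`'s kinetic energy across the window (velocities jump only at `i`'s own collisions; pre-collisional
velocities are flight velocities, `HardSphereFlow.preVel_partner_nthCollisionTimeOf_zero/succ`). -/
def Coboundary : Prop :=
  ∀ (σ : ℝ), 0 < σ → σ < 1 / 2 → ∀ (N : ℕ) (Φ : Flow σ N) (z : Cfg N), z ∈ Φ.good →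
    ∀ (a b : ℝ), a ≤ b → ∀ i : Fin (N + 1),
      Φ.collisionSum (Set.Ioc a b) (gainOf N i) z = (‖(Φ.flow b z i).2‖ ^ 2 - ‖(Φ.flow a z i).2‖ ^ 2) / 2

/-! ## The gain recorded at one collision -/

variable {σ : ℝ} {N : ℕ}

/-- At a configuration in which `i` takes part in no collision the ordered contact pairs carry no gain of `i`: every contact
pair `(p, q)` has `p` participating, so `p ≠ i`. -/
theorem sum_contactPairs_gainOf_of_not_participates {ε : ℝ} (i : Fin (N + 1)) {w : Cfg N} (t : ℝ)
    (hi : ¬ Participates (Torus.geometry (Fin 3)) ε w i) :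
    ∑ p ∈ contactPairs (Torus.geometry (Fin 3)) ε w,
        gainOf N i (HardSphereCollisionRecord.ofConfig (Torus.geometry (Fin 3)) ε w t p.1 p.2) = 0 := by
  refine Finset.sum_eq_zero ?_
  rintro ⟨p, q⟩ hp
  have hpi : p ≠ i := by
    rintro rfl
    exact hi ⟨q, Or.inl hp⟩
  simp [gainOf, hpi]

/-- **The gain recorded at a collision of `i`.**  Along a good orbit (`hsDiameter σ N < 1/2`: regular geometry, binary
collisions), at a time `t` at which `i` collides the ordered contact pairs are `(i, partner)` and `(partner, i)`
(`IsHardSphereTrajectory.contactPairs_eq_pair`), and only the first carries a gain of `i`: the pair sum of `gainOf N i`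
(records stamped with any time `t₀`) is `(‖v_i(t)‖² − ‖v_i(t⁻)‖²)/2`, the pre-collisional velocity `v_i(t⁻)` being the one
recorded through the partner. -/
theorem sum_contactPairs_gainOf_of_participates (hσ2 : hsDiameter σ N < 2⁻¹) (Φ : Flow σ N) {w : Cfg N}
    (hw : w ∈ Φ.good) (i : Fin (N + 1)) (t t₀ : ℝ)
    (hi : Participates (Torus.geometry (Fin 3)) (hsDiameter σ N) (Φ.flow t w) i) :
    ∑ p ∈ contactPairs (Torus.geometry (Fin 3)) (hsDiameter σ N) (Φ.flow t w),
        gainOf N i (HardSphereCollisionRecord.ofConfig (Torus.geometry (Fin 3)) (hsDiameter σ N) (Φ.flow t w) t₀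
          p.1 p.2) =
      (‖(Φ.flow t w i).2‖ ^ 2 -
        ‖(HardSphereCollisionRecord.ofConfig (Torus.geometry (Fin 3)) (hsDiameter σ N) (Φ.flow t w) t₀ i
            (partner (Torus.geometry (Fin 3)) (hsDiameter σ N) (Φ.flow t w) i)).preVel.1‖ ^ 2) / 2 := by
  have hG := Torus.isHardSphereRegular_geometry (d := Fin 3) hσ2
  have hγ := Φ.isTrajectory w hw
  set j := partner (Torus.geometry (Fin 3)) (hsDiameter σ N) (Φ.flow t w) i
  -- the contact pair oriented `(i, partner)` (pattern of `HardSphereFlow.preVel_partner_eq_vel`)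
  have hij : (i, j) ∈ contactPairs (Torus.geometry (Fin 3)) (hsDiameter σ N) (Φ.flow t w) := by
    rcases collide_partner hi with h | h
    · exact h
    · exact (swap_mem_contactPairs_iff hG (p := (i, j))).1 h
  have hne' : i ≠ j := (mem_contactPairs.1 hij).1
  have hne : (i, j) ≠ (j, i) := fun h => hne' (Prod.mk.inj h).1
  rw [hγ.contactPairs_eq_pair hG (t := t) hij, Finset.sum_pair hne]
  have h1 : gainOf N i (HardSphereCollisionRecord.ofConfig (Torus.geometry (Fin 3)) (hsDiameter σ N) (Φ.flow t w) t₀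
      i j) = (‖(Φ.flow t w i).2‖ ^ 2 -
        ‖(HardSphereCollisionRecord.ofConfig (Torus.geometry (Fin 3)) (hsDiameter σ N) (Φ.flow t w) t₀ i
            j).preVel.1‖ ^ 2) / 2 := by
    rw [gainOf, HardSphereCollisionRecord.ofConfig_fst, if_pos rfl, HardSphereCollisionRecord.ofConfig_postVel]
  have h2 : gainOf N i (HardSphereCollisionRecord.ofConfig (Torus.geometry (Fin 3)) (hsDiameter σ N) (Φ.flow t w) t₀
      j i) = 0 := by
    rw [gainOf, HardSphereCollisionRecord.ofConfig_fst, if_neg fun h => hne' h.symm]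
  rw [h1, h2, add_zero]

/-! ## Telescoping over a window `(0, h]` -/

/-- **Telescoping over the window `(0, h]`.**  On the good set (`hsDiameter σ N < 1/2`, `0 ≤ h`) the collision sum over
`(0, h]` of `i`'s signed gains is `(‖v_i(h)‖² − ‖v_i(0)‖²)/2`: the collision times of `i` in the window are its enumerated
collision times `t_0 < ⋯ < t_{J−1}` (`HardSphereWindowEnumeration`), the gain recorded at `t_n` is
`(‖v_i(t_n)‖² − ‖v_i(t_{n−1})‖²)/2` with `v_i(t_{−1}) = v_i(0)` (pre-collisional velocities are flight velocities,
`HardSphereFlow.preVel_partner_nthCollisionTimeOf_zero / _succ`), the sum telescopes (`Finset.sum_range_sub`), and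
`v_i(h) = v_i(t_{J−1})` since `i` has no collision in `(t_{J−1}, h]` (`HardSphereFlow.vel_flow_eq_of_forall_not_participates`).
-/
theorem collisionSum_gainOf_Ioc_zero (hσ2 : hsDiameter σ N < 2⁻¹) (Φ : Flow σ N) {w : Cfg N} (hw : w ∈ Φ.good)
    {h : ℝ} (hh : 0 ≤ h) (i : Fin (N + 1)) :
    Φ.collisionSum (Set.Ioc 0 h) (gainOf N i) w = (‖(Φ.flow h w i).2‖ ^ 2 - ‖(w i).2‖ ^ 2) / 2 := by
  classical
  have hfin := Φ.finite_collisionTimes_inter hw (S := Set.Ioc 0 h) Set.Ioc_subset_Icc_self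
  -- the number `J` of collisions of `i` in the window and its enumerated collision times `T n`, `n < J`
  obtain ⟨J, hJ⟩ : ∃ J : ℕ, (collisionTimesOf (Torus.geometry (Fin 3)) (hsDiameter σ N) (fun s => Φ.flow s w) i ∩
      Set.Ioc 0 h).ncard = J := ⟨_, rfl⟩
  have hlt : ∀ {n : ℕ}, n < J → n < (collisionTimesOf (Torus.geometry (Fin 3)) (hsDiameter σ N)
      (fun s => Φ.flow s w) i ∩ Set.Ioc 0 h).ncard := fun hn => hJ ▸ hn
  set T : ℕ → ℝ := fun n => Φ.nthCollisionTimeOf i n w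
  have hmem : ∀ n < J, T n ∈ collisionTimesOf (Torus.geometry (Fin 3)) (hsDiameter σ N) (fun s => Φ.flow s w) i ∩
      Set.Ioc 0 h := fun n hn => Φ.nthCollisionTimeOf_mem_window hw i (hlt hn)
  have hmono : StrictMonoOn T (Set.Iio J) := by
    rw [← hJ]
    exact Φ.strictMonoOn_nthCollisionTimeOf_window hw i h
  have hsurj : ∀ u ∈ collisionTimesOf (Torus.geometry (Fin 3)) (hsDiameter σ N) (fun s => Φ.flow s w) i ∩
      Set.Ioc 0 h, ∃ n < J, T n = u := by
    intro u hu
    obtain ⟨n, hn, hnu⟩ := Φ.exists_lt_ncard_nthCollisionTimeOf_eq hw i hu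
    exact ⟨n, hJ ▸ hn, hnu⟩
  -- Step 1: the collision sum is the sum over `n < J` of the pair sums at the times `T n`
  have hsub : (Finset.range J).image T ⊆ hfin.toFinset := by
    intro t ht
    obtain ⟨n, hn, rfl⟩ := Finset.mem_image.1 ht
    have hm := hmem n (Finset.mem_range.1 hn)
    exact (Set.Finite.mem_toFinset hfin).2 ⟨collisionTimesOf_subset _ i hm.1, hm.2⟩
  have hzero : ∀ t ∈ hfin.toFinset, t ∉ (Finset.range J).image T →
      ∑ p ∈ contactPairs (Torus.geometry (Fin 3)) (hsDiameter σ N) (Φ.flow t w),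
        gainOf N i (HardSphereCollisionRecord.ofConfig (Torus.geometry (Fin 3)) (hsDiameter σ N) (Φ.flow t w) t
          p.1 p.2) = 0 := by
    intro t ht hti
    refine sum_contactPairs_gainOf_of_not_participates i t fun hpi => hti ?_
    obtain ⟨n, hn, hnt⟩ := hsurj t ⟨hpi, ((Set.Finite.mem_toFinset hfin).1 ht).2⟩
    exact Finset.mem_image.2 ⟨n, Finset.mem_range.2 hn, hnt⟩
  have hinj : Set.InjOn T ↑(Finset.range J) := by
    rw [Finset.coe_range]
    exact hmono.injOn
  have h1 : Φ.collisionSum (Set.Ioc 0 h) (gainOf N i) w = ∑ n ∈ Finset.range J,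
      ∑ p ∈ contactPairs (Torus.geometry (Fin 3)) (hsDiameter σ N) (Φ.flow (T n) w),
        gainOf N i (HardSphereCollisionRecord.ofConfig (Torus.geometry (Fin 3)) (hsDiameter σ N) (Φ.flow (T n) w)
          (T n) p.1 p.2) := by
    rw [HardSphereFlow.collisionSum_eq, collisionSum_eq_finset_sum hfin]
    exact (Finset.sum_subset hsub hzero).symm.trans (Finset.sum_image hinj)
  -- Step 2: the pair sum at `T n` is the jump `E (n + 1) - E n` of the kinetic energy of `i` along its flights
  set E : ℕ → ℝ := fun n => Nat.casesOn n (‖(w i).2‖ ^ 2 / 2) fun m => ‖(Φ.flow (T m) w i).2‖ ^ 2 / 2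
  have hE0 : E 0 = ‖(w i).2‖ ^ 2 / 2 := rfl
  have hES : ∀ m, E (m + 1) = ‖(Φ.flow (T m) w i).2‖ ^ 2 / 2 := fun m => rfl
  have h2 : ∀ n ∈ Finset.range J,
      ∑ p ∈ contactPairs (Torus.geometry (Fin 3)) (hsDiameter σ N) (Φ.flow (T n) w),
        gainOf N i (HardSphereCollisionRecord.ofConfig (Torus.geometry (Fin 3)) (hsDiameter σ N) (Φ.flow (T n) w)
          (T n) p.1 p.2) = E (n + 1) - E n := by
    intro n hn
    have hn' := hlt (Finset.mem_range.1 hn)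
    rw [sum_contactPairs_gainOf_of_participates hσ2 Φ hw i (T n) (T n) (hmem n (Finset.mem_range.1 hn)).1]
    cases n with
    | zero =>
      rw [hES, hE0, Φ.preVel_partner_nthCollisionTimeOf_zero hσ2 hw i hn' (T 0)]
      ring
    | succ m =>
      rw [hES, hES, Φ.preVel_partner_nthCollisionTimeOf_succ hσ2 hw i hn' (T (m + 1))]
      ring
  -- Step 3: after its last collision in the window (or from time `0` if it has none) `i` keeps its velocity up to `h`
  have h3 : E J = ‖(Φ.flow h w i).2‖ ^ 2 / 2 := by
    cases J with
    | zero =>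
      rw [hE0, Φ.vel_flow_eq_of_forall_not_participates hw i hh, Φ.flow_zero w hw]
      intro u hu hpu
      obtain ⟨n, hn, -⟩ := hsurj u ⟨hpu, hu⟩
      exact (Nat.not_lt_zero n) hn
    | succ m =>
      have hm := hmem m m.lt_succ_self
      rw [hES, Φ.vel_flow_eq_of_forall_not_participates hw i hm.2.2]
      intro u hu hpu
      obtain ⟨n, hn, hnu⟩ := hsurj u ⟨hpu, hm.2.1.trans hu.1, hu.2⟩
      have hle : T n ≤ T m := hmono.monotoneOn hn m.lt_succ_self (Nat.lt_succ_iff.1 hn)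
      rw [hnu] at hle
      exact (not_lt.2 hle) hu.1
  rw [h1, Finset.sum_congr rfl h2, Finset.sum_range_sub, h3, hE0]
  ring

/-! ## The stub -/

/-- **Stub K2 (registered): the coboundary identity** on every window `(a, b]`, `a ≤ b`, of a good orbit (`0 < σ < 1/2`):
shift the window to `(0, b − a]` along the orbit of `Φ_a z` (`EnergyCurrentTailsLevelCensus.collisionSum_Ioc_eq_collisionSum_flow`;
the gain does not read the time stamp of the record), telescope there (`collisionSum_gainOf_Ioc_zero`, diameter
`hsDiameter σ N ≤ σ < 1/2`), and return with the group property `Φ_b z = Φ_{b−a} (Φ_a z)`. -/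
theorem stub_coboundary : Coboundary := by
  intro σ hσ hσ2 N Φ z hz a b hab i
  have h2 : σ < 2⁻¹ := by rwa [← one_div]
  have hε : hsDiameter σ N < 2⁻¹ := (hsDiameter_le hσ.le N).trans_lt h2
  have hza : Φ.flow a z ∈ Φ.good := Φ.mapsTo_good a hz
  rw [EnergyCurrentTailsLevelCensus.collisionSum_Ioc_eq_collisionSum_flow Φ hz a b (gainOf N i)
      fun _ _ _ _ _ => rfl,
    collisionSum_gainOf_Ioc_zero hε Φ hza (sub_nonneg.2 hab) i, ← Φ.flow_add (b - a) a z hz, sub_add_cancel]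

end Summit.AtomisticToContinuum.HydrodynamicLimit.Theorems.EnergyActivityTailsCoboundary

end
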